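import Mathlib.Analysis.Matrix.Order
import Mathlib.Algebra.QuadraticDiscriminant
import Mathlib.Data.Sign.Basic
import HarnessLib

/-!
# Steepest descent directions for the quadratic and `ℓ₁` norms, and the convergence algebra of the
# steepest descent method (Boyd–Vandenberghe 2004, §9.4.1–§9.4.3, (9.23)-(9.27))

Topic `Literature/Analysis/Convex`; namespace `Literature.Analysis.Convex.SteepestDescent`.
Everything here is PROVED; def-free; no named facts.

[BV04 §9.4]: the normalized steepest descent direction `Δx_nsd = argmin{∇f(x)ᵀv : ‖v‖ ≤ 1}`
(9.23), the unnormalized step `Δx_sd = ‖∇f(x)‖_* Δx_nsd` (9.24) with `∇f(x)ᵀΔx_sd = −‖∇f(x)‖_*²`.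
§9.4.1, quadratic norm `‖z‖_P = (zᵀPz)^{1/2}`, `P ≻ 0`: `Δx_nsd = −(∇fᵀP⁻¹∇f)^{−1/2} P⁻¹∇f`,
dual norm `‖z‖_* = (zᵀP⁻¹z)^{1/2}`, `Δx_sd = −P⁻¹∇f(x)` (9.25). §9.4.2, `ℓ₁`-norm: with `i` an index
of a largest `|∂f/∂xᵢ| = ‖∇f‖_∞`, `Δx_nsd = −sign(∂f/∂xᵢ) eᵢ`, `Δx_sd = −(∂f/∂xᵢ) eᵢ` (coordinate
descent). §9.4.3: from `∇²f ⪯ MI` and `‖·‖ ≥ γ‖·‖₂` the bound (9.26), the backtracking exit at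
`t̂ = γ²/M` (9.27), and the linear rate `c = 1 − 2mαγ̃² min{1, βγ²/M}`.

Below `g` stands for `∇f(x)`, `P` is symmetric positive semidefinite with `PQ = I` (so `Q = P⁻¹`);
positive semidefiniteness enters as the plain hypothesis `∀ x, 0 ≤ xᵀPx`.

* `steepest_quadNorm_lower` — (via a private Cauchy–Schwarz for `zᵀPz`) every `v` with
  `‖v‖_P ≤ 1` has `gᵀv ≥ −‖g‖_*`; `steepest_quadNorm_attained` — the direction of §9.4.1 has
  `‖·‖_P = 1` and attains `−‖g‖_*` (so it is `Δx_nsd`); `steepest_quadNorm_step` /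
  `quadNorm_sq_of_step` — (9.25): `gᵀ(−Qg) = −‖g‖_*²`, `‖−Qg‖_P = ‖g‖_*`.
* `steepest_l1_lower`, `steepest_l1_attained`, `l1Norm_of_nsd`, `steepest_l1_step` — §9.4.2.
* `backtracking_exit_at_that` — (9.26) at `t̂ = γ²/M` gives (9.27); `steepest_rate` — the
  per-step contraction `f(x⁺) − p⋆ ≤ c (f(x) − p⋆)`.

Related, not restated: the gradient method bounds (9.17)-(9.19) and (9.9) live in
`Literature.Analysis.Convex.StrongConvexityBounds`; here (9.9) is a hypothesis of `steepest_rate`.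
Not formalised: the change-of-coordinates interpretation `x̄ = P^{1/2}x` and Example 9.2.

## References

* S. Boyd, L. Vandenberghe, *Convex Optimization*, Cambridge University Press (2004), §9.4
  (9.23)-(9.27). [BoydVandenberghe2004] (held scan [galaxy:panama:376041566634042], text read)
-/

open Matrix Finset

namespace Literature.Analysis.Convex.SteepestDescent

variable {n : Type*} [Fintype n]

/-- Plumbing: for symmetric `P`, `(Pu)ᵀv = uᵀ(Pv)`. [folklore] -/
private theorem mulVec_dotProduct_symm {P : Matrix n n ℝ} (hP : Pᵀ = P) (u v : n → ℝ) :
    (P *ᵥ u) ⬝ᵥ v = u ⬝ᵥ P *ᵥ v := by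
  conv_lhs => rw [← hP]
  rw [mulVec_transpose, ← dotProduct_mulVec]

/-! ## §9.4.1 Quadratic norm -/

/-- Plumbing: Cauchy–Schwarz for the semidefinite form `‖z‖_P² = zᵀPz`, `(aᵀPb)² ≤ (aᵀPa)(bᵀPb)`
(discriminant of `t ↦ (a + tb)ᵀP(a + tb) ≥ 0`). Kept private: public copies with this exact
signature are `dotProduct_mulVec_sq_le` in `Literature/MathematicalPhysics/QuantumFieldTheory/GaussianToolkit.lean`
and `Matrix.PosSemidef.dotProduct_mulVec_sq_le` in
`Literature/Geometry/Lorentzian/InverseMeanCurvatureFlowWeakGradient.lean` (not imported here to keep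
this anchor's import closure inside Mathlib). [folklore] -/
private theorem quadForm_cauchy_schwarz {P : Matrix n n ℝ} (hP : Pᵀ = P) (hpsd : ∀ x, 0 ≤ x ⬝ᵥ P *ᵥ x)
    (a b : n → ℝ) : (a ⬝ᵥ P *ᵥ b) ^ 2 ≤ (a ⬝ᵥ P *ᵥ a) * (b ⬝ᵥ P *ᵥ b) := by
  have hsym : b ⬝ᵥ P *ᵥ a = a ⬝ᵥ P *ᵥ b := by
    rw [← mulVec_dotProduct_symm hP b a, dotProduct_comm]
  have hquad : ∀ t : ℝ,
      0 ≤ (b ⬝ᵥ P *ᵥ b) * (t * t) + (2 * (a ⬝ᵥ P *ᵥ b)) * t + a ⬝ᵥ P *ᵥ a := by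
    intro t
    have h := hpsd (a + t • b)
    rw [mulVec_add, mulVec_smul, add_dotProduct, dotProduct_add, dotProduct_add, smul_dotProduct,
      smul_dotProduct, dotProduct_smul, dotProduct_smul, hsym] at h
    simp only [smul_eq_mul] at h
    linarith
  have hd := discrim_le_zero hquad
  rw [discrim] at hd
  nlinarith [hd]

/-- `‖g‖_*² = gᵀP⁻¹g = (P⁻¹g)ᵀP(P⁻¹g) ≥ 0`: the step `−P⁻¹g` has `P`-norm `‖g‖_*`
("`Δx_sd = ‖∇f(x)‖_* Δx_nsd`"). [cite: BoydVandenberghe2004, §9.4.1 (9.24)-(9.25)] -/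
theorem quadNorm_sq_of_step [DecidableEq n] {P Q : Matrix n n ℝ} (hPQ : P * Q = 1) (g : n → ℝ) :
    (Q *ᵥ g) ⬝ᵥ P *ᵥ (Q *ᵥ g) = g ⬝ᵥ Q *ᵥ g := by
  rw [mulVec_mulVec, hPQ, one_mulVec, dotProduct_comm]

/-- Nonnegativity of `‖g‖_*² = gᵀP⁻¹g` for `P ⪰ 0`. [cite: BoydVandenberghe2004, §9.4.1 (9.24)] -/
theorem dualQuadNorm_sq_nonneg [DecidableEq n] {P Q : Matrix n n ℝ} (hpsd : ∀ x, 0 ≤ x ⬝ᵥ P *ᵥ x)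
    (hPQ : P * Q = 1) (g : n → ℝ) : 0 ≤ g ⬝ᵥ Q *ᵥ g := by
  rw [← quadNorm_sq_of_step hPQ g]
  exact hpsd _

/-- **(9.25)**: the steepest descent step for the quadratic norm, `Δx_sd = −P⁻¹∇f(x)`, has
`∇f(x)ᵀΔx_sd = −∇fᵀP⁻¹∇f = −‖∇f(x)‖_*²`. [cite: BoydVandenberghe2004, §9.4.1 (9.24)-(9.25)] -/
theorem steepest_quadNorm_step (Q : Matrix n n ℝ) (g : n → ℝ) :
    g ⬝ᵥ (-(Q *ᵥ g)) = -(g ⬝ᵥ Q *ᵥ g) := by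
  rw [dotProduct_neg]

/-- Every `v` in the unit ball of `‖·‖_P` satisfies `∇fᵀv ≥ −‖∇f‖_* = −(∇fᵀP⁻¹∇f)^{1/2}`
(the value attained by `Δx_nsd`, next theorem): `Δx_nsd = argmin{∇f(x)ᵀv : ‖v‖_P ≤ 1}`.
[cite: BoydVandenberghe2004, §9.4.1 (9.23)] -/
theorem steepest_quadNorm_lower [DecidableEq n] {P Q : Matrix n n ℝ} (hP : Pᵀ = P) (hpsd : ∀ x, 0 ≤ x ⬝ᵥ P *ᵥ x)
    (hPQ : P * Q = 1) (g v : n → ℝ) (hv : v ⬝ᵥ P *ᵥ v ≤ 1) :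
    -Real.sqrt (g ⬝ᵥ Q *ᵥ g) ≤ g ⬝ᵥ v := by
  have hg : g ⬝ᵥ v = (Q *ᵥ g) ⬝ᵥ P *ᵥ v := by
    rw [← mulVec_dotProduct_symm hP, mulVec_mulVec, hPQ, one_mulVec]
  have hcs := quadForm_cauchy_schwarz hP hpsd (Q *ᵥ g) v
  rw [quadNorm_sq_of_step hPQ, ← hg] at hcs
  have h0 : 0 ≤ g ⬝ᵥ Q *ᵥ g := dualQuadNorm_sq_nonneg hpsd hPQ g
  have hsq : (g ⬝ᵥ v) ^ 2 ≤ g ⬝ᵥ Q *ᵥ g := by nlinarith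
  have habs := Real.abs_le_sqrt hsq
  exact (abs_le.1 habs).1

/-- The normalized steepest descent direction for `‖·‖_P`,
`Δx_nsd = −(∇fᵀP⁻¹∇f)^{−1/2} P⁻¹∇f` (when `∇f ≠ 0`, i.e. `∇fᵀP⁻¹∇f > 0`): it has `‖Δx_nsd‖_P = 1`
and `∇fᵀΔx_nsd = −‖∇f‖_*`, the minimum over the unit ball. [cite: BoydVandenberghe2004, §9.4.1 (9.23)-(9.24)] -/
theorem steepest_quadNorm_attained [DecidableEq n] {P Q : Matrix n n ℝ} (hPQ : P * Q = 1) (g : n → ℝ)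
    (hg : 0 < g ⬝ᵥ Q *ᵥ g) :
    ((-(1 / Real.sqrt (g ⬝ᵥ Q *ᵥ g))) • Q *ᵥ g) ⬝ᵥ P *ᵥ ((-(1 / Real.sqrt (g ⬝ᵥ Q *ᵥ g))) • Q *ᵥ g)
        = 1 ∧
      g ⬝ᵥ ((-(1 / Real.sqrt (g ⬝ᵥ Q *ᵥ g))) • Q *ᵥ g) = -Real.sqrt (g ⬝ᵥ Q *ᵥ g) := by
  set r := Real.sqrt (g ⬝ᵥ Q *ᵥ g) with hr
  have hs : 0 < r := Real.sqrt_pos.2 hg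
  have hss : r * r = g ⬝ᵥ Q *ᵥ g := Real.mul_self_sqrt hg.le
  constructor
  · rw [mulVec_smul, smul_dotProduct, dotProduct_smul, quadNorm_sq_of_step hPQ, smul_eq_mul,
      smul_eq_mul, ← hss]
    calc -(1 / r) * (-(1 / r) * (r * r)) = (r / r) * (r / r) := by ring
      _ = 1 := by rw [div_self hs.ne', mul_one]
  · rw [dotProduct_smul, smul_eq_mul, ← hss]
    calc -(1 / r) * (r * r) = -(r * (r / r)) := by ring
      _ = -r := by rw [div_self hs.ne', mul_one]

/-! ## §9.4.2 `ℓ₁`-norm (coordinate descent) -/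

/-- Every `v` with `‖v‖₁ ≤ 1` has `∇fᵀv ≥ −‖∇f‖_∞ = −|∂f/∂xᵢ|` for an index `i` of a largest
component. [cite: BoydVandenberghe2004, §9.4.2] -/
theorem steepest_l1_lower (g v : n → ℝ) (i : n) (hi : ∀ j, |g j| ≤ |g i|) (hv : ∑ j, |v j| ≤ 1) :
    -|g i| ≤ g ⬝ᵥ v := by
  have h1 : -(∑ j, |g i| * |v j|) ≤ g ⬝ᵥ v := by
    rw [dotProduct, ← Finset.sum_neg_distrib]
    refine Finset.sum_le_sum fun j _ => ?_
    have := neg_abs_le (g j * v j)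
    rw [abs_mul] at this
    nlinarith [hi j, abs_nonneg (v j), abs_nonneg (g j)]
  rw [← Finset.mul_sum] at h1
  nlinarith [abs_nonneg (g i), h1]

/-- `Δx_nsd = −sign(∂f(x)/∂xᵢ) eᵢ` attains the bound: `∇fᵀΔx_nsd = −|∂f/∂xᵢ| = −‖∇f‖_∞`.
[cite: BoydVandenberghe2004, §9.4.2] -/
theorem steepest_l1_attained [DecidableEq n] (g : n → ℝ) (i : n) :
    g ⬝ᵥ (-((SignType.sign (g i) : ℝ) • Pi.single i (1 : ℝ))) = -|g i| := by
  rw [dotProduct_neg, dotProduct_smul, dotProduct_single, mul_one, smul_eq_mul, sign_mul_self]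

/-- … and has unit `ℓ₁`-norm when `∂f/∂xᵢ ≠ 0`. [cite: BoydVandenberghe2004, §9.4.2] -/
theorem l1Norm_of_nsd [DecidableEq n] (g : n → ℝ) (i : n) (hgi : g i ≠ 0) :
    ∑ j, |(-((SignType.sign (g i) : ℝ) • Pi.single i (1 : ℝ))) j| = 1 := by
  have hsg : |(SignType.sign (g i) : ℝ)| = 1 := by
    rcases lt_trichotomy (g i) 0 with h | h | h
    · rw [sign_neg h]; simp
    · exact absurd h hgi
    · rw [sign_pos h]; simp
  rw [Finset.sum_eq_single i]
  · simp [hsg]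
  · intro j _ hj
    simp [Pi.single_eq_of_ne hj]
  · intro h; exact absurd (Finset.mem_univ i) h

/-- The unnormalized `ℓ₁` steepest descent step `Δx_sd = Δx_nsd ‖∇f‖_∞ = −(∂f/∂xᵢ) eᵢ` has
`∇fᵀΔx_sd = −(∂f/∂xᵢ)² = −‖∇f‖_∞²`. [cite: BoydVandenberghe2004, §9.4.2, (9.24)] -/
theorem steepest_l1_step [DecidableEq n] (g : n → ℝ) (i : n) :
    g ⬝ᵥ (-(g i • Pi.single i (1 : ℝ))) = -(g i) ^ 2 := by
  rw [dotProduct_neg, dotProduct_smul, dotProduct_single, mul_one, smul_eq_mul, sq]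

/-! ## §9.4.3 Convergence analysis -/

/-- **(9.26) ⇒ (9.27)**: with `s² = ‖∇f(x)‖_*²`, the quadratic upper bound
`f(x + tΔx_sd) ≤ f(x) − ts² + (M/(2γ²)) t² s²` evaluated at `t̂ = γ²/M` gives
`f(x + t̂Δx_sd) ≤ f(x) − (γ²/(2M)) s² ≤ f(x) + α t̂ ∇fᵀΔx_sd` for `α < 1/2` — the backtracking exit
condition holds at `t̂`. [cite: BoydVandenberghe2004, §9.4.3 (9.26)-(9.27)] -/
theorem backtracking_exit_at_that {fx fxt s2 M γ α : ℝ} (hM : 0 < M) (hγ : 0 < γ) (hα : α < 1 / 2)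
    (hs : 0 ≤ s2)
    (hub : fxt ≤ fx - (γ ^ 2 / M) * s2 + M / (2 * γ ^ 2) * (γ ^ 2 / M) ^ 2 * s2) :
    fxt ≤ fx - γ ^ 2 / (2 * M) * s2 ∧ fx - γ ^ 2 / (2 * M) * s2 ≤ fx + α * (γ ^ 2 / M) * (-s2) := by
  have hγ2 : 0 < γ ^ 2 := by positivity
  have hkey : M / (2 * γ ^ 2) * (γ ^ 2 / M) ^ 2 = γ ^ 2 / (2 * M) := by
    field_simp
  constructor
  · rw [hkey] at hub
    have : fx - γ ^ 2 / M * s2 + γ ^ 2 / (2 * M) * s2 = fx - γ ^ 2 / (2 * M) * s2 := by ring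
    linarith
  · have h1 : α * (γ ^ 2 / M) * s2 ≤ (1 / 2) * (γ ^ 2 / M) * s2 := by
      have : 0 ≤ γ ^ 2 / M * s2 := by positivity
      nlinarith
    have h2 : (1 / 2) * (γ ^ 2 / M) * s2 = γ ^ 2 / (2 * M) * s2 := by
      field_simp
    linarith

/-- **Linear convergence of the steepest descent method** (§9.4.3): if the line search yields
`f(x⁺) ≤ f(x) − α t_min ‖∇f(x)‖_*²` (`t_min = min{1, βγ²/M}`), the dual norm dominates
`‖∇f‖_*² ≥ γ̃²‖∇f‖₂²`, and strong convexity gives (9.9) `‖∇f(x)‖₂² ≥ 2m(f(x) − p⋆)`, then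
`f(x⁺) − p⋆ ≤ c (f(x) − p⋆)` with `c = 1 − 2mαγ̃² t_min`. [cite: BoydVandenberghe2004, §9.4.3] -/
theorem steepest_rate {f fp p m α γt tmin s2 g2 : ℝ} (hα : 0 ≤ α) (ht : 0 ≤ tmin)
    (hstep : fp ≤ f - α * tmin * s2) (hdual : γt ^ 2 * g2 ≤ s2) (h99 : 2 * m * (f - p) ≤ g2) :
    fp - p ≤ (1 - 2 * m * α * γt ^ 2 * tmin) * (f - p) := by
  have h1 : α * tmin * (γt ^ 2 * g2) ≤ α * tmin * s2 :=
    mul_le_mul_of_nonneg_left hdual (mul_nonneg hα ht)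
  have h2 : α * tmin * γt ^ 2 * (2 * m * (f - p)) ≤ α * tmin * γt ^ 2 * g2 :=
    mul_le_mul_of_nonneg_left h99 (by positivity)
  nlinarith

/-- The contraction factor is `< 1` as soon as `m, α, γ̃, t_min > 0` ("`c = 1 − 2mαγ̃² min{1, βγ²/M} < 1`").
[cite: BoydVandenberghe2004, §9.4.3] -/
theorem steepest_rate_lt_one {m α γt tmin : ℝ} (hm : 0 < m) (hα : 0 < α) (hγ : 0 < γt)
    (ht : 0 < tmin) : 1 - 2 * m * α * γt ^ 2 * tmin < 1 := by
  have : 0 < 2 * m * α * γt ^ 2 * tmin := by positivity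
  linarith

end Literature.Analysis.Convex.SteepestDescent
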